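import Mathlib.MeasureTheory.Integral.IntervalIntegral.Basic
import Mathlib.Topology.EMetricSpace.BoundedVariation
import Literature.Probability.RandomPlanarGeometry.TangentAtSLE6
import Literature.Probability.RandomPlanarGeometry.ZoomFlow
import Literature.Probability.RandomPlanarGeometry.SLELawOfDrivingProcess
import Literature.Probability.RandomPlanarGeometry.LocalMartingale
import HarnessLib

/-!
# The three sectors of first-order deformations of the SLE₆ chordal family

Companion of `TangentAtSLE6.lean` (definition item `defn-TangentAtSLE6`, route CardyAnchoredRigidity
of `CriticalPhenomena/CardyFormulaZ2`, "wanted API: the three SECTORS as subspaces"). Each sector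
is a family of genuine DEFORMATION CURVES of a base family `P₀` (intended: the chordal SLE₆
family); its velocities (`ChordalFamily.velocity`, along a test class `𝒯`) generate a subspace of
the common ambient space `ChordalFamily.Deformation`, so that "every tangent vector is a sum of
elements of the three sectors" is a statement about ONE vector space:

* (i) TWISTS — `ChordalFamily.pullback S Φ` (run the family in the deformed marked domain
  `(Φ D)(D; a, b)` and pull the curve back by `(Φ D)⁻¹`; `anchoredPullback S Ψ`: one map per
  target point, `Φ D = Ψ (D.pt 1)`, literally the formula of route item AnchoredPullbackAxioms),
  `twistVelocities P₀ 𝒯` (velocities of `ε ↦ pullback P₀ (Φ ε)`, `Φ 0 = id`),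
  `anchoredTwistVelocities`, `twistSector = span`. Beltrami directions (`Φ ε D` quasiconformal of
  dilatation `εμ`, measurable Riemann mapping theorem) are among these; no quasiconformality is
  imposed, see the design notes.
* (ii) DRIFTS / DIFFUSIVITY and (iii) FINITE-VARIATION (SINGULAR) DRIVER PERTURBATIONS —
  `perturbedDriving k A ε = √(6 + εk) B + ε A` on the canonical space, `IsDrivenFamily U φ P`
  (`P D` = law of the Loewner curve driven by the random driver `U` through the chordal
  uniformizing map `φ D`, via the tree's `Loewner.IsDrivenBy`), the perturbation classes
  `cameronMartinPerturbations` (`A = ∫₀ᵗ β ds`, `β` bounded progressive for the Brownian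
  filtration) and `finiteVariationPerturbations` (progressive, continuous paths of locally bounded
  variation from `0`), `driverVelocities P₀ 𝒯 𝒜`, `driftSector`, `singularDriverSector`;
* `namedSectors P₀ 𝒯 = twistSector ⊔ driftSector ⊔ singularDriverSector`.

API / non-vacuity: `pullback_refl`, `anchoredPullback_apply` (`rfl` against the route's inline
formula), `zero_mem_twistVelocities`, `perturbedDriving_zero` (`W⁰ = sleDriving 6`),
`exists_isDrivenFamily_of_isSLELaw` (a family of SLE₆ laws IS a driven family for `√6 B`),
`zero_mem_cameronMartinPerturbations`, `zero_mem_finiteVariationPerturbations`,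
`zero_mem_driverVelocities` (at SLE₆ the unperturbed driver gives the constant curve), and the
inclusions of the generating sets in `tangentCone Set.univ P₀ 𝒯`.

## Design notes (what is NOT here)

* The sectors are defined at the level of LAWS (curves of chordal families), the only level at
  which they can be compared; membership of a velocity requires the corresponding curve of
  families to be `C¹` along `𝒯` (`IsDeformationCurve.contDiffAt`), a hypothesis on the curve.
* (i) imposes no Beltrami / quasiconformal structure on the fields `Φ ε D` and no smoothness in
  `ε` beyond differentiability of the resulting coordinates; identifying the sector with Beltrami
  fields `μ` needs the measurable Riemann mapping theorem (Astala–Iwaniec–Martin 2009, Thm 5.3.2),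
  absent from Mathlib. The anchoring conditions of the route (similarity conjugation, mirror
  intertwining) are hypotheses of its items, not part of the sector.
* (ii)/(iii): the laws of perturbed-driver curves depend on the chosen uniformizing maps `φ D`
  unless the perturbation is scale covariant; `driverVelocities` therefore quantifies over a FIXED
  but arbitrary choice `φ`. `finiteVariationPerturbations ⊇` the Cameron–Martin ones; what (iii)
  adds is their singular part (e.g. local times), which is not singled out by a predicate here.
  Existence of the perturbed Loewner curves (Girsanov + Rohde–Schramm) is not claimed: it is the
  content of the hypothesis `∀ ε, IsDrivenFamily (perturbedDriving k A ε) φ (c ε)`.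
* No statement of the route (SectorExhaustion, GermSignLemma) is made here.

## Sources

G. Lawler, O. Schramm, W. Werner, Acta Math. 187 (2001) §2 (coordinate changes of SLE₆ under
conformal maps; locality); G. Lawler, *Conformally Invariant Processes in the Plane* (2005) §6.3
(chordal SLE in a domain through a uniformizing map); D. Revuz, M. Yor, *Continuous Martingales and
Brownian Motion* (1999) Ch. VIII §1 (Cameron–Martin / Girsanov drifts); K. Astala, T. Iwaniec,
G. Martin, *Elliptic PDE and Quasiconformal Mappings in the Plane* (2009) Thm 5.3.2 (measurable
Riemann mapping theorem — context only). Mathlib: `Submodule.span`, `MeasureTheory.IsProgressive`,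
`intervalIntegral`, `LocallyBoundedVariationOn`, `Measure.map_id`. Tree: `TangentAtSLE6` (all
notions), `MarkedDomain.map_refl`, `CurveClass.map_homeomorph_refl` (ZoomFlow),
`Loewner.IsDrivenBy`, `IsSLECurve.exists_ae_isDrivenBy` (SLELawOfDrivingProcess),
`brownianFiltration` (LocalMartingale), `sleDriving`, `IsSLELaw` (SLE), `IsChordalUniformizing`,
`ConformalEquiv.boundaryExtension` (ConformalRectangle / ConformalMap).
-/

noncomputable section

open Set MeasureTheory Topology Filter
open scoped NNReal ENNReal

namespace Literature.Probability.RandomPlanarGeometry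

namespace ChordalFamily

/-! ### Sector (i): twists — pull-backs along fields of plane homeomorphisms -/

/-- **Pull-back of a chordal family along a field of plane homeomorphisms** indexed by Dobrushin
domains: `(pullback S Φ) D = (Φ D)⁻¹_* (S (Φ D · D))` — run the family in the deformed marked
domain `(Φ D)(D; a, b)` and pull the curve back. For `Φ D` quasiconformal this is the family `S`
read in the conformal structure with Beltrami coefficient `μ_{Φ D}` (measurable Riemann mapping
theorem, Astala–Iwaniec–Martin 2009 Thm 5.3.2, not used here); for `Φ D` conformal between the
domains and `S` conformally covariant it returns `S D`. [folklore] -/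
def pullback (S : ChordalFamily) (Φ : DobrushinDomain → ℂ ≃ₜ ℂ) : ChordalFamily :=
  fun D => (S (D.map (Φ D))).map (CurveClass.map ((Φ D).symm : C(ℂ, ℂ)))

/-- Unfolding `pullback`. [folklore] -/
theorem pullback_apply (S : ChordalFamily) (Φ : DobrushinDomain → ℂ ≃ₜ ℂ) (D : DobrushinDomain) :
    pullback S Φ D = (S (D.map (Φ D))).map (CurveClass.map ((Φ D).symm : C(ℂ, ℂ))) := rfl

/-- **Target-anchored pull-back**: the field is a function of the target point alone,
`Φ D = Ψ (D.pt 1)` ("one map per target `b`"), as in the route items AnchoredPullbackAxioms /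
StretchedPullbackNotTargetBlind of CardyAnchoredRigidity (`P D := (Ψ_{D.pt 1})⁻¹_* S(Ψ_{D.pt 1} D)`,
e.g. the radial stretch `Ψ_b = F_{c,b} : z ↦ b + (z − b)|z − b|^{2c/(1−c)}`). [folklore] -/
def anchoredPullback (S : ChordalFamily) (Ψ : ℂ → ℂ ≃ₜ ℂ) : ChordalFamily :=
  pullback S fun D => Ψ (D.pt 1)

/-- `anchoredPullback` is literally the formula inlined in route item AnchoredPullbackAxioms.
[folklore] -/
theorem anchoredPullback_apply (S : ChordalFamily) (Ψ : ℂ → ℂ ≃ₜ ℂ) (D : DobrushinDomain) :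
    anchoredPullback S Ψ D =
      (S (D.map (Ψ (D.pt 1)))).map (CurveClass.map ((Ψ (D.pt 1)).symm : C(ℂ, ℂ))) := rfl

/-- Pulling back along the identity field does nothing. [folklore] -/
theorem pullback_refl (S : ChordalFamily) : pullback S (fun _ => Homeomorph.refl ℂ) = S := by
  funext D
  rw [pullback_apply, MarkedDomain.map_refl, Homeomorph.refl_symm, CurveClass.map_homeomorph_refl,
    Measure.map_id]

/-- **Twist velocities at `P₀` along `𝒯`** (sector (i) of the request, generators): velocities of
the pull-back curves `ε ↦ pullback P₀ (Φ ε)` along one-parameter fields of plane homeomorphisms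
through the identity (`Φ 0 D = id`) that are `C¹` along `𝒯`. This CONTAINS the Beltrami
directions of the request ("`Ṗ = d/dε (F^ε)_* P⁰` with `F^ε` quasiconformal of dilatation `εμ`"):
no quasiconformality or `ε`-smoothness of the field is imposed beyond the differentiability of
the resulting curve of families, so statements quantifying over this sector are not weaker than
over the Beltrami one. [folklore] -/
def twistVelocities (P₀ : ChordalFamily) (𝒯 : Set (CurveClass ℂ → ℝ)) : Set Deformation :=
  {v | ∃ Φ : ℝ → DobrushinDomain → ℂ ≃ₜ ℂ, (∀ D, Φ 0 D = Homeomorph.refl ℂ) ∧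
    IsDeformationCurve Set.univ 𝒯 P₀ (fun ε => pullback P₀ (Φ ε)) ∧
      velocity 𝒯 (fun ε => pullback P₀ (Φ ε)) = v}

/-- **Target-anchored twist velocities**: as `twistVelocities` with fields anchored at the target,
`Φ ε D = Ψ ε (D.pt 1)` with `Ψ ε b` fixing `b` (the "target-axis twist sector" of the route:
Beltrami fields `c (z − b)/(z̄ − b̄)` integrate to such `Ψ`). [folklore] -/
def anchoredTwistVelocities (P₀ : ChordalFamily) (𝒯 : Set (CurveClass ℂ → ℝ)) :
    Set Deformation :=
  {v | ∃ Ψ : ℝ → ℂ → ℂ ≃ₜ ℂ, (∀ b, Ψ 0 b = Homeomorph.refl ℂ) ∧ (∀ ε b, Ψ ε b b = b) ∧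
    IsDeformationCurve Set.univ 𝒯 P₀ (fun ε => anchoredPullback P₀ (Ψ ε)) ∧
      velocity 𝒯 (fun ε => anchoredPullback P₀ (Ψ ε)) = v}

/-- **The twist sector** (sector (i) as a subspace): the linear span of the twist velocities.
[folklore] -/
def twistSector (P₀ : ChordalFamily) (𝒯 : Set (CurveClass ℂ → ℝ)) : Submodule ℝ Deformation :=
  Submodule.span ℝ (twistVelocities P₀ 𝒯)

/-- Anchored twist velocities are twist velocities. [folklore] -/
theorem anchoredTwistVelocities_subset (P₀ : ChordalFamily) (𝒯 : Set (CurveClass ℂ → ℝ)) :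
    anchoredTwistVelocities P₀ 𝒯 ⊆ twistVelocities P₀ 𝒯 := by
  rintro v ⟨Ψ, h0, -, hc, rfl⟩
  exact ⟨fun ε D => Ψ ε (D.pt 1), fun D => h0 _, hc, rfl⟩

/-- The identity field gives the zero twist velocity (non-vacuity of sector (i)). [folklore] -/
theorem zero_mem_twistVelocities (P₀ : ChordalFamily) (𝒯 : Set (CurveClass ℂ → ℝ)) :
    (0 : Deformation) ∈ twistVelocities P₀ 𝒯 := by
  refine ⟨fun _ _ => Homeomorph.refl ℂ, fun _ => rfl, ?_, ?_⟩
  · simpa only [pullback_refl] using isDeformationCurve_const (Set.mem_univ P₀)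
  · simpa only [pullback_refl] using velocity_const 𝒯 P₀

/-- Twist velocities are tangent vectors of the class of all families. [folklore] -/
theorem twistVelocities_subset_tangentCone (P₀ : ChordalFamily) (𝒯 : Set (CurveClass ℂ → ℝ)) :
    twistVelocities P₀ 𝒯 ⊆ tangentCone Set.univ P₀ 𝒯 := by
  rintro v ⟨Φ, -, hc, rfl⟩
  exact ⟨_, hc, rfl⟩

/-! ### Sectors (ii)–(iii): deformations of the driving process -/

/-- **Perturbed SLE₆ driving function** on the canonical space: diffusivity `6 ↦ 6 + ε k` and an
additive perturbation `ε · A` of the Brownian driver,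
`W^ε_t(ω) = √(6 + ε k) · B_t(ω) + ε · A_t(ω)` (`W⁰ = √6 B = sleDriving 6`). With `A = ∫₀ᵗ β ds`,
`β` adapted, this is the Cameron–Martin / Girsanov direction of the request; with `A` of finite
variation but not absolutely continuous, its singular direction. [folklore] -/
def perturbedDriving (k : ℝ) (A : ℝ≥0 → (ℝ≥0 → ℝ) → ℝ) (ε : ℝ) (ω : ℝ≥0 → ℝ) (t : ℝ≥0) : ℝ :=
  Real.sqrt (6 + ε * k) * Process.brownian t ω + ε * A t ω

/-- At `ε = 0` the perturbed driver is the SLE₆ driving function `√6 B`. [folklore] -/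
@[simp] theorem perturbedDriving_zero (k : ℝ) (A : ℝ≥0 → (ℝ≥0 → ℝ) → ℝ) :
    perturbedDriving k A 0 = sleDriving 6 := by
  funext ω t
  simp [perturbedDriving, sleDriving_apply]

/-- **`P` is the family of laws of the chordal Loewner curves driven by the random driving
function `U`** through the uniformizing maps `φ D : ℍ → D`: for every Dobrushin domain there is an
a.e.-measurable random curve class, a.s. driven by `U ω` through the boundary extension of `φ D`
and ending at `b = D.pt 1` (`Loewner.IsDrivenBy`), whose law is `P D`. A family of chordal
SLE_κ laws is driven by `U = sleDriving κ` through suitable chordal uniformizing maps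
(`exists_isDrivenFamily_of_isSLELaw`); for drivers that are not scale invariant in law the
family DEPENDS on the choice of `φ` (recorded as data). Lawler 2005 §6.3; CDHKS 2014 §1.
[folklore] -/
def IsDrivenFamily (U : (ℝ≥0 → ℝ) → ℝ≥0 → ℝ)
    (φ : ∀ D : DobrushinDomain, ConformalEquiv UpperHalfPlane.upperHalfPlaneSet D.carrier)
    (P : ChordalFamily) : Prop :=
  ∀ D : DobrushinDomain, ∃ Γ : (ℝ≥0 → ℝ) → CurveClass ℂ,
    AEMeasurable Γ Process.preWienerMeasure ∧
      (∀ᵐ ω ∂Process.preWienerMeasure,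
        Loewner.IsDrivenBy (φ D).boundaryExtension (D.pt 1) (U ω) (Γ ω)) ∧
      P D = Process.preWienerMeasure.map Γ

/-- A family of chordal SLE₆ laws is driven by `√6 B` through suitable chordal uniformizing maps
(unfolding of `IsSLELaw` / `IsSLECurve`). [folklore] -/
theorem exists_isDrivenFamily_of_isSLELaw {P₀ : ChordalFamily} (h : ∀ D, IsSLELaw 6 D (P₀ D)) :
    ∃ φ : ∀ D : DobrushinDomain, ConformalEquiv UpperHalfPlane.upperHalfPlaneSet D.carrier,
      (∀ D : DobrushinDomain, D.IsChordalUniformizing (φ D)) ∧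
        IsDrivenFamily (sleDriving 6) φ P₀ := by
  choose Γ hΓ hP using h
  choose φ hφ hae using fun D => (hΓ D).exists_ae_isDrivenBy
  exact ⟨φ, hφ, fun D => ⟨Γ D, (hΓ D).aemeasurable, hae D, hP D⟩⟩

/-- **Cameron–Martin (Girsanov) perturbations of the driver**: `A_t = ∫₀ᵗ β_s ds` with `β`
bounded and progressively measurable for the Brownian filtration of the canonical space
("Girsanov derivatives of the `√6·B` driving law by adapted functionals"). Revuz–Yor Ch. VIII §1
(Cameron–Martin space of adapted drifts). [folklore] -/
def cameronMartinPerturbations : Set (ℝ≥0 → (ℝ≥0 → ℝ) → ℝ) :=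
  {A | ∃ β : ℝ≥0 → (ℝ≥0 → ℝ) → ℝ, MeasureTheory.IsProgressive brownianFiltration β ∧
    (∃ C : ℝ, ∀ t ω, |β t ω| ≤ C) ∧
      ∀ t ω, A t ω = ∫ s in (0 : ℝ)..(t : ℝ), β (Real.toNNReal s) ω}

/-- **Finite-variation perturbations of the driver**: progressively measurable `A` with
continuous paths of locally bounded variation starting at `0` (contains the Cameron–Martin ones;
the SINGULAR ones — e.g. local times of sets of times — are what sector (iii) of the request adds).
[folklore] -/
def finiteVariationPerturbations : Set (ℝ≥0 → (ℝ≥0 → ℝ) → ℝ) :=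
  {A | MeasureTheory.IsProgressive brownianFiltration A ∧
    ∀ ω, A 0 ω = 0 ∧ Continuous (fun t => A t ω) ∧
      LocallyBoundedVariationOn (fun t => A t ω) Set.univ}

/-- The zero perturbation is a Cameron–Martin perturbation (`β = 0`). [folklore] -/
theorem zero_mem_cameronMartinPerturbations : (0 : ℝ≥0 → (ℝ≥0 → ℝ) → ℝ) ∈
    cameronMartinPerturbations :=
  ⟨0, MeasureTheory.isProgressive_const _ 0, ⟨0, fun _ _ => by simp⟩, fun t ω => by simp⟩

/-- The zero perturbation is a finite-variation perturbation. [folklore] -/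
theorem zero_mem_finiteVariationPerturbations : (0 : ℝ≥0 → (ℝ≥0 → ℝ) → ℝ) ∈
    finiteVariationPerturbations := by
  refine ⟨MeasureTheory.isProgressive_const _ 0, fun ω => ⟨rfl, continuous_const, ?_⟩⟩
  refine BoundedVariationOn.locallyBoundedVariationOn ?_
  rw [BoundedVariationOn, eVariationOn.constant_on]
  · exact ENNReal.zero_ne_top
  · exact (Set.subsingleton_singleton (a := (0 : ℝ))).anti (by rintro _ ⟨t, -, rfl⟩; rfl)

/-- **Driver velocities at `P₀` along `𝒯` with perturbations from `𝒜`** (sectors (ii)/(iii),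
generators): velocities of `C¹`-along-`𝒯` curves `ε ↦ P^ε` of driven families, `P^ε` the laws of
the Loewner curves driven by `W^ε = √(6 + εk) B + ε A` (`A ∈ 𝒜`, `k ∈ ℝ` the diffusivity
direction) through a FIXED choice of chordal uniformizing maps, with `P⁰ = P₀`. [folklore] -/
def driverVelocities (P₀ : ChordalFamily) (𝒯 : Set (CurveClass ℂ → ℝ))
    (𝒜 : Set (ℝ≥0 → (ℝ≥0 → ℝ) → ℝ)) : Set Deformation :=
  {v | ∃ (k : ℝ) (A : ℝ≥0 → (ℝ≥0 → ℝ) → ℝ)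
      (φ : ∀ D : DobrushinDomain, ConformalEquiv UpperHalfPlane.upperHalfPlaneSet D.carrier)
      (c : ℝ → ChordalFamily),
    A ∈ 𝒜 ∧ (∀ D : DobrushinDomain, D.IsChordalUniformizing (φ D)) ∧
      (∀ ε, IsDrivenFamily (perturbedDriving k A ε) φ (c ε)) ∧
        IsDeformationCurve Set.univ 𝒯 P₀ c ∧ velocity 𝒯 c = v}

/-- **The drift–diffusivity sector** (sector (ii) as a subspace): span of the driver velocities
with Cameron–Martin perturbations. [folklore] -/
def driftSector (P₀ : ChordalFamily) (𝒯 : Set (CurveClass ℂ → ℝ)) : Submodule ℝ Deformation :=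
  Submodule.span ℝ (driverVelocities P₀ 𝒯 cameronMartinPerturbations)

/-- **The finite-variation (singular) driver sector** (sector (iii) as a subspace): span of the
driver velocities with finite-variation perturbations. [folklore] -/
def singularDriverSector (P₀ : ChordalFamily) (𝒯 : Set (CurveClass ℂ → ℝ)) :
    Submodule ℝ Deformation :=
  Submodule.span ℝ (driverVelocities P₀ 𝒯 finiteVariationPerturbations)

/-- The three named sectors together: `twistSector ⊔ driftSector ⊔ singularDriverSector` (the
subspace a "sum of sectors" lies in). [folklore] -/
def namedSectors (P₀ : ChordalFamily) (𝒯 : Set (CurveClass ℂ → ℝ)) : Submodule ℝ Deformation :=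
  twistSector P₀ 𝒯 ⊔ driftSector P₀ 𝒯 ⊔ singularDriverSector P₀ 𝒯

/-- Driver velocities are monotone in the perturbation class. [folklore] -/
theorem driverVelocities_mono (P₀ : ChordalFamily) (𝒯 : Set (CurveClass ℂ → ℝ))
    {𝒜 𝒜' : Set (ℝ≥0 → (ℝ≥0 → ℝ) → ℝ)} (h : 𝒜 ⊆ 𝒜') :
    driverVelocities P₀ 𝒯 𝒜 ⊆ driverVelocities P₀ 𝒯 𝒜' := by
  rintro v ⟨k, A, φ, c, hA, hφ, hd, hc, rfl⟩
  exact ⟨k, A, φ, c, h hA, hφ, hd, hc, rfl⟩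

/-- Driver velocities are tangent vectors of the class of all families. [folklore] -/
theorem driverVelocities_subset_tangentCone (P₀ : ChordalFamily) (𝒯 : Set (CurveClass ℂ → ℝ))
    (𝒜 : Set (ℝ≥0 → (ℝ≥0 → ℝ) → ℝ)) : driverVelocities P₀ 𝒯 𝒜 ⊆ tangentCone Set.univ P₀ 𝒯 := by
  rintro v ⟨k, A, φ, c, -, -, -, hc, rfl⟩
  exact ⟨c, hc, rfl⟩

/-- **Non-vacuity of the driver sectors at SLE₆.** At a family of chordal SLE₆ laws the unperturbed
driver (`k = 0`, `A = 0 ∈ 𝒜`) gives the constant curve, so `0` is a driver velocity. [folklore] -/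
theorem zero_mem_driverVelocities {P₀ : ChordalFamily} (h : ∀ D, IsSLELaw 6 D (P₀ D))
    (𝒯 : Set (CurveClass ℂ → ℝ)) {𝒜 : Set (ℝ≥0 → (ℝ≥0 → ℝ) → ℝ)} (h𝒜 : (0 : _) ∈ 𝒜) :
    (0 : Deformation) ∈ driverVelocities P₀ 𝒯 𝒜 := by
  obtain ⟨φ, hφ, hdrv⟩ := exists_isDrivenFamily_of_isSLELaw h
  refine ⟨0, 0, φ, fun _ => P₀, h𝒜, hφ, fun ε => ?_, isDeformationCurve_const (Set.mem_univ P₀),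
    velocity_const 𝒯 P₀⟩
  have hU : perturbedDriving 0 0 ε = sleDriving 6 := by
    funext ω t
    simp [perturbedDriving, sleDriving_apply]
  rw [hU]
  exact hdrv

/-- Hence `0` lies in each named sector and in their sum (trivially, as these are subspaces; the
point of the previous lemmas is that the GENERATING sets are inhabited by genuine curves).
[folklore] -/
theorem zero_mem_namedSectors (P₀ : ChordalFamily) (𝒯 : Set (CurveClass ℂ → ℝ)) :
    (0 : Deformation) ∈ namedSectors P₀ 𝒯 :=
  Submodule.zero_mem _

end ChordalFamily

end Literature.Probability.RandomPlanarGeometry
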